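import Literature.AlgebraicGeometry.Pohlmann1968.NondegenerateCMTypeFamilies
import Literature.AlgebraicGeometry.Pohlmann1968.CMTypeRankCharactersNumberField
import HarnessLib

/-!
# Products of CM abelian varieties with CM by one GALOIS CM field are stably degenerate: exceptional Hodge
# classes on `A^k × A'^l` for CM-inequivalent simple `A, A'` (COR-CM cell note, kernel form)

COR-CM (cell `pub-hodgecm2`, portfolio seat `lit-deligne-3` gen 3), count-neutral; a consequence — NEW as stated, hence
placed under `Summits/` — of two Literature theorems landed tonight and of Deligne's description of the Mumford–Tate
group of a CM abelian variety:

* `Literature.AlgebraicGeometry.Pohlmann1968.NondegenerateCMTypeFamilies` (Deligne 1982 I Ex. 3.7 for the CM algebra `K^I`;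
  Gordon 1999 Thm. 7.5 (Murty 1984, Hazama 1985) for CM products over one field: for a SEPARATING family `(Φ_i)_{i∈I}` of CM
  types of a CM field `K` — members primitive and pairwise CM-inequivalent, i.e. the `A_{Φ_i}` simple and "nonisogenous" in
  Gordon's Def. 7.4 — and every family of realisations `A_i`, the family is nondegenerate (`cmFamilyRank Φ = |I|·n + 1`,
  `[K:ℚ] = 2n`) iff no product `⨁_j A_{π j}` supports an exotic Hodge class: `exists_exceptional_prod_of_not_isNondegenerateFamily`);
* Deligne, LNM 900, I Ex. 3.7 (c) (re-ed. p. 26): "`Y(G)` is the `Gal(ℚ̄/ℚ)`-module generated by `μ`" — so `rank Y(G)` is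
  at most the number of Galois conjugates of `μ`; for `K/ℚ` NORMAL the action of `Aut(ℂ)` on `Hom(K, ℂ)` factors through
  `Gal(K/ℚ)` (Shimura §8.1; the tree's `Pohlmann1968.exists_algEquiv_comp_eq_smul`, `smul_embOf_of_comp`), whence
  `cmFamilyRank Φ ≤ |Gal(K/ℚ)| = [K:ℚ] = 2n` (`cmFamilyRank_le_card_algEquiv`, `cmFamilyRank_le_finrank`).

CONSEQUENCE (`not_isNondegenerateFamily_of_two_le_card`, `exists_exceptional_prod_of_normal`): since `|I|·n + 1 > 2n` as
soon as `|I| ≥ 2`, NO family with two or more members of CM types of a Galois CM field is nondegenerate; therefore for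
every separating family with `|I| ≥ 2` and every family of realisations, SOME product `⨁_{j<N} A_{π j}` carries a rational
`(m,m)` class outside `Dᵐ ⊗ ℂ` — e.g. any two CM-inequivalent simple CM abelian varieties `A, A'` with CM by the same
Galois CM field have a product `A^k × A'^l` with an exceptional Hodge class (the combinatorial shadow of the fact that
Deligne's proof for CM abelian varieties needs the Weil classes of Thm. 4.8 and not only divisors).  For `|I| = 1` the
bound is Shimura's `rank ≤ n + 1 ≤ 2n` and says nothing.

Everything is PROVED; theorems only; no named fact; no `sorry`.  Not a binder row; no TOP statement is touched.

## References

* [Deligne1982HodgeCycles] P. Deligne, *Hodge cycles on abelian varieties*, LNM 900 (1982), I Ex. 3.7 (c).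
* [Gordon1999HodgeAVSurvey] B. B. Gordon, *A survey of the Hodge conjecture for abelian varieties*, 7.4–7.6.1.
* [Shimura1998] G. Shimura, *Abelian Varieties with Complex Multiplication and Modular Functions*, §8.1.

Provenance: Literature home (family `hodge`, namespace `Literature.AlgebraicGeometry.ComplexMultiplication.GaloisExoticProducts`) of the Summits-side `CorCM/GaloisCMFieldExoticProducts` (cell `pub-hodgecm2`, COR-CM; all its imports are `Literature/` and Mathlib), which `Literature/` may not import; theorems only, no named fact, no definition. Nothing here bears on `HC_CM`. Lane `lit-hodgefound` (Layer A3: CM types, their Kubota ranks and Galois combinatorics), seat p20.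
-/

noncomputable section

open _root_.CategoryTheory _root_.CategoryTheory.Limits NumberField

namespace Literature.AlgebraicGeometry.ComplexMultiplication.GaloisExoticProducts

open Literature.NumberTheory.ComplexMultiplication
open Literature.AlgebraicGeometry.Motives (AbelianVariety CMType)
open Literature.AlgebraicGeometry.HodgeTheory
open Literature.AlgebraicGeometry.ComplexMultiplication (IsCMTypeRealisation)
open Literature.AlgebraicGeometry.VanGeemen1994 (hodgeClassSpan)
open Literature.AlgebraicGeometry.Pohlmann1968
open Literature.Barriers.HodgeConjecture (divisorClassesSpan)

variable {K : Type} [Field K] [NumberField K] {I : Type} [Fintype I]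

/-- **For `K/ℚ` normal the rank of a family is at most `|Gal(K/ℚ)|`**: every `τ ∈ Aut(ℂ)` acts on `Hom(K, ℂ)` as
right translation by some `γ_τ⁻¹ ∈ Gal(K/ℚ)` in Shimura's indexing `σ_g = φ₀ ∘ g⁻¹` (`smul_embOf_of_comp`), so the
indicator of the translate `τ • Σ` of Deligne's `Σ ⊆ I × Hom(K, ℂ)` only depends on `γ_τ`: at most `|Gal(K/ℚ)|` distinct
translates span `Y(G) ⊗ ℚ` ("`Y(G)` is the `Gal(ℚ̄/ℚ)`-module generated by `μ`").
[cite: Deligne1982HodgeCycles, I Ex. 3.7 (c) (p. 26)] [cite: Shimura1998, §8.1] -/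
theorem cmFamilyRank_le_card_algEquiv [Normal ℚ K] (Φ : I → CMType K) :
    cmFamilyRank Φ ≤ Fintype.card (K ≃ₐ[ℚ] K) := by
  classical
  obtain ⟨φ₀⟩ := (inferInstance : Nonempty (K →+* ℂ))
  let e : (K ≃ₐ[ℚ] K) ≃ (K →+* ℂ) := Equiv.ofBijective (embOf φ₀) (embOf_bijective φ₀)
  have he : ∀ g, e g = embOf φ₀ g := fun _ => rfl
  -- the translate by `τ` only depends on `γ_τ ∈ Gal(K/ℚ)`
  let F : (K ≃ₐ[ℚ] K) → ((_ : I) × (K →+* ℂ)) → ℚ := fun δ x =>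
    if (⟨x.1, embOf φ₀ (e.symm x.2 * δ⁻¹)⟩ : (_ : I) × (K →+* ℂ)) ∈ familyType Φ then 1 else 0
  have hrange : (Set.range fun τ : ℂ ≃+* ℂ => translateInd (familyType Φ) τ) ⊆ Set.range F := by
    rintro _ ⟨τ, rfl⟩
    obtain ⟨δ, hδ⟩ := exists_algEquiv_comp_eq_smul φ₀ τ
    refine ⟨δ, funext fun x => ?_⟩
    have hx : τ • x = ⟨x.1, embOf φ₀ (e.symm x.2 * δ⁻¹)⟩ := by
      obtain ⟨i, s⟩ := x
      rw [smul_sigma_mk]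
      have hs : s = embOf φ₀ (e.symm s) := by rw [← he, Equiv.apply_symm_apply]
      conv_lhs => rw [hs]
      rw [smul_embOf_of_comp φ₀ hδ (e.symm s)]
    show F δ x = translateInd (familyType Φ) τ x
    simp only [F]
    by_cases hmem : τ • x ∈ familyType Φ
    · rw [translateInd_of_mem hmem]
      rw [hx] at hmem
      rw [if_pos hmem]
    · rw [translateInd_of_not_mem hmem]
      rw [hx] at hmem
      rw [if_neg hmem]
  calc cmFamilyRank Φ
      = Module.finrank ℚ (Submodule.span ℚ (Set.range fun τ : ℂ ≃+* ℂ => translateInd (familyType Φ) τ)) := rfl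
    _ ≤ Module.finrank ℚ (Submodule.span ℚ (Set.range F)) := Submodule.finrank_mono (Submodule.span_mono hrange)
    _ ≤ Fintype.card (K ≃ₐ[ℚ] K) := finrank_range_le_card F

/-- **For `K/ℚ` normal, `cmFamilyRank Φ ≤ [K : ℚ]`** (`|Gal(K/ℚ)| = [K:ℚ]`, the Galois group being in bijection with
`Hom(K, ℂ)`: `embOf_bijective`). [cite: Deligne1982HodgeCycles, I Ex. 3.7 (c) (p. 26)] [cite: Shimura1998, §8.1] -/
theorem cmFamilyRank_le_finrank [Normal ℚ K] (Φ : I → CMType K) : cmFamilyRank Φ ≤ Module.finrank ℚ K := by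
  obtain ⟨φ₀⟩ := (inferInstance : Nonempty (K →+* ℂ))
  have hcardG : Fintype.card (K ≃ₐ[ℚ] K) = Module.finrank ℚ K := by
    rw [Fintype.card_congr (Equiv.ofBijective (embOf φ₀) (embOf_bijective φ₀))]
    exact NumberField.Embeddings.card K ℂ
  rw [← hcardG]
  exact cmFamilyRank_le_card_algEquiv Φ

/-- **No family with two or more members of CM types of a GALOIS CM field is nondegenerate**: nondegeneracy asks for
`cmFamilyRank Φ = |I|·[K:ℚ]/2 + 1 ≥ [K:ℚ] + 1`, while `cmFamilyRank Φ ≤ [K:ℚ]` — on Mumford–Tate groups: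
`dim MT(∏_i A_{Φ_i}) ≤ [K:ℚ] < rdim + 1` for two or more non-isogenous simple factors, so `∏_i A_{Φ_i}` is STABLY
DEGENERATE in the sense of Gordon 7.6 / 8.8. [cite: Gordon1999HodgeAVSurvey, 7.5–7.7 and 8.8]
[cite: Deligne1982HodgeCycles, I Ex. 3.7 (c) (p. 26)] -/
theorem not_isNondegenerateFamily_of_two_le_card [Normal ℚ K] (Φ : I → CMType K) (hI : 2 ≤ Fintype.card I) :
    ¬IsNondegenerateFamily Φ := by
  intro h
  rw [isNondegenerateFamily_iff] at h
  have h1 := cmFamilyRank_le_finrank Φ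
  have h2 : 2 * Module.finrank ℚ K / 2 ≤ Fintype.card I * Module.finrank ℚ K / 2 :=
    Nat.div_le_div_right (Nat.mul_le_mul_right _ hI)
  rw [Nat.mul_div_cancel_left _ (by norm_num : 0 < 2)] at h2
  omega

variable [IsCMField K] [Nonempty I] {Φ : I → CMType K}
variable {A : I → AbelianVariety ℂ} {ι : ∀ i, 𝓞 K →+* End (A i)}
  {θ : ∀ i, K →+* Module.End ℂ (complexBetti (A i).X 1)}

/-- **Exceptional Hodge classes on products of CM abelian varieties with CM by one Galois CM field.**  Let `K` be a
Galois (normal) CM field and `(Φ_i)_{i∈I}`, `|I| ≥ 2`, a SEPARATING family of CM types of `K` (members primitive and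
pairwise CM-inequivalent: `A_{Φ_i}` simple and pairwise non-isomorphic as CM abelian varieties).  Then for every family of
realisations `(A_i, ι_i, θ_i)` some product `⨁_{j<N} A_{π j}` (`π : Fin N → I`) carries a rational `(m,m)` class OUTSIDE
`Dᵐ ⊗ ℂ` — in particular two CM-inequivalent simple CM abelian varieties `A, A'` with CM by the same Galois CM field always
have a product `A^k × A'^l` supporting an exceptional Hodge class.  (= `not_isNondegenerateFamily_of_two_le_card` +
Gordon Thm. 7.5 (1) ⟹ (3) in the kernel form `exists_exceptional_prod_of_not_isNondegenerateFamily`.)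
[cite: Gordon1999HodgeAVSurvey, 7.5 and 8.8] [cite: Deligne1982HodgeCycles, I Ex. 3.7 (c) (p. 26)] -/
theorem exists_exceptional_prod_of_normal [Normal ℚ K] (hsep : IsSeparatingFamily Φ) (hI : 2 ≤ Fintype.card I)
    (hA : ∀ i, IsCMTypeRealisation (Φ i) (A i) (ι i) (θ i)) :
    ∃ (N : ℕ) (π : Fin N → I) (m : ℕ) (c : complexBetti (⨁ fun j : Fin N => A (π j)).X (2 * m)),
      IsRationalClass c ∧
      IsOfHodgeType (⨁ fun j : Fin N => A (π j)).dim (⨁ fun j : Fin N => A (π j)).X (2 * m) m m c ∧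
      c ∉ divisorClassesSpan (⨁ fun j : Fin N => A (π j)).X (⨁ fun j : Fin N => A (π j)).dim m :=
  exists_exceptional_prod_of_not_isNondegenerateFamily hsep (not_isNondegenerateFamily_of_two_le_card Φ hI) hA

/-- The same for products: for a Galois CM field and a separating family with `|I| ≥ 2`, NOT every product
`⨁_{j<N} A_{π j}` has `Bᵐ ⊗ ℂ = Dᵐ ⊗ ℂ` (Gordon 7.5 (1) fails: the index of degeneracy 8.8 is finite).
[cite: Gordon1999HodgeAVSurvey, 7.5 and 8.8] -/
theorem not_forall_prod_hodgeClassSpan_eq_of_normal [Normal ℚ K] (hsep : IsSeparatingFamily Φ)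
    (hI : 2 ≤ Fintype.card I) (hA : ∀ i, IsCMTypeRealisation (Φ i) (A i) (ι i) (θ i)) :
    ¬∀ (N : ℕ) (π : Fin N → I) (m : ℕ),
      hodgeClassSpan (⨁ fun j : Fin N => A (π j)).dim (⨁ fun j : Fin N => A (π j)).X m =
        divisorClassesSpan (⨁ fun j : Fin N => A (π j)).X (⨁ fun j : Fin N => A (π j)).dim m := fun h =>
  not_isNondegenerateFamily_of_two_le_card Φ hI ((isNondegenerateFamily_iff_forall_prod_hodgeClassSpan_eq hsep hA).2 h)

end Literature.AlgebraicGeometry.ComplexMultiplication.GaloisExoticProducts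

end
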